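import Summits.RiemannHypothesis.RiemannHypothesis.Theses.SpectralTrace
import Summits.RiemannHypothesis.RiemannHypothesis.Theorems.WindowTraceArch.Negative.LocalWeyl
import Summits.RiemannHypothesis.RiemannHypothesis.Theorems.WindowTraceArch.Negative.LocalWeylTools
import Summits.RiemannHypothesis.RiemannHypothesis.Theorems.WindowTraceArch.Negative.UnitMass
import Literature.NumberTheory.LFunctions.WeilMellinBounds
import HarnessLib

/-!
# Crux `SpectralThesis` (stmt-RiemannHypothesis-0187), line `Sketch` — cells for the closed ladder

Helper file for the stub `stub_closedLadder` (closedness of the open-window rungs under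
increasing limits of the window). A family `γ : ι → ℝ` reproducing the Weil functional on the
Weil tests supported in a fixed closed window `[-B, B]` is chopped into the integer cells
`(n, n+1]`; this file provides the three quantitative inputs of the cell-wise ultrafilter limit:

* `exists_uniform_card_near_le_log` : the local Weyl upper bound
  `#{i ∈ s : |γ_i - T| ≤ 1} ≤ C (1 + log(1 + |T|))` with a constant `C = C(B)` that does NOT
  depend on the family (the proof of `card_near_le_log_of_windowTrace` in
  `Theorems/WindowTraceArch/Negative/LocalWeyl.lean` builds `C` from the window only; we re-run
  it with the quantifiers in this order);
* `norm_weilMellin_line_le_sq`, `norm_weilMellin_cell_le` : the decay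
  `‖ĝ(1/2 + iu)‖ ≤ D_g / (1 + u²)²` on the critical line (two more integrations by parts than
  `norm_weilMellin_le`) and its form on a cell, `≤ 16 D_g / (1 + n²)²` for `u ∈ [n, n+1]`;
* `finite_and_natCard_le`, `hasSum_fiber`, `summable_cellBound` : finiteness of the cells,
  regrouping of a `HasSum` along the cells, and summability of the dominating sequence
  `C (2 + |n|) · 16 D / (1 + n²)²`.
-/

noncomputable section

set_option linter.dupNamespace false

open Complex Set MeasureTheory Filter
open scoped Real Topology ContDiff ComplexConjugate

namespace Summit.RiemannHypothesis.RiemannHypothesis.Theorems.SpectralThesis.Sketch.ClosedLadder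

open Literature.NumberTheory.LFunctions
open Literature.Analysis.SpecialFunctions
open Summit.RiemannHypothesis.RiemannHypothesis.Theorems.WindowTraceArch.Negative

/-! ### The local Weyl law with a family-independent constant -/

/-- **Uniform local Weyl upper bound.** For every window `B > 0` there is a constant `C > 0`
such that EVERY real family `γ` reproducing the Weil functional on the Weil tests supported in
`[-B, B]` has at most `C (1 + log(1 + |T|))` points (counted in any finset) in `[T-1, T+1]`.
Same proof as `card_near_le_log_of_windowTrace` (modulated autocorrelation of a narrow bump,
`exists_bump_lower`, `weilMellin_modulate`, `sum_norm_sq_le_of_windowTrace`, Yoshida's analytic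
form `weilQuadratic_re_eq_weilArchQuadratic` and `reDigammaQuarter_le_log`); the family enters
only through the Bochner bound `Σ |ŵ_T(γ_i)|² ≤ Re Q(w_T)`, after the constant is fixed.
[folklore] -/
theorem exists_uniform_card_near_le_log {B : ℝ} (hB : 0 < B) :
    ∃ C : ℝ, 0 < C ∧ ∀ {ι : Type} (γ : ι → ℝ),
      (∀ g : ℝ → ℂ, IsWeilTest g → tsupport g ⊆ Icc (-B) B →
        HasSum (fun i => weilMellin g (1 / 2 + (γ i : ℂ) * I)) (weilFunctional g)) →
      ∀ (T : ℝ) (s : Finset ι), (∀ i ∈ s, |γ i - T| ≤ 1) →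
        (s.card : ℝ) ≤ C * (1 + Real.log (1 + |T|)) := by
  -- the bump
  set δ : ℝ := min (B / 2) (min (Real.log 2 / 2) (1 / 2)) with hδ_def
  have hlog2 : 0 < Real.log 2 := Real.log_pos one_lt_two
  have hδ : 0 < δ := lt_min (half_pos hB) (lt_min (half_pos hlog2) one_half_pos)
  have hδA : δ ≤ B / 2 := min_le_left _ _
  have hδl : δ ≤ Real.log 2 / 2 := (min_le_right _ _).trans (min_le_left _ _)
  have hδ1 : δ ≤ 1 / 2 := (min_le_right _ _).trans (min_le_right _ _)
  obtain ⟨w, hw, hws, hw1, c, hc, hlow⟩ := exists_bump_lower hδ hδ1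
  -- constants
  set L : ℝ := weilL1 w with hL
  have hL0 : 0 ≤ L := weilL1_nonneg w
  set P : ℝ := ∫ v : ℝ, ‖weilMellin w (1 / 2 + v * I)‖ ^ 2 with hP
  have hP0 : 0 ≤ P := integral_nonneg fun _ => by positivity
  set K : ℝ := ∫ v : ℝ, ‖weilMellin w (1 / 2 + v * I)‖ ^ 2 * (5 + Real.log (1 + |v|)) with hK
  have hK0 : 0 ≤ K := integral_nonneg fun v => by
    have : 0 ≤ Real.log (1 + |v|) := Real.log_nonneg (by linarith [abs_nonneg v])
    positivity
  refine ⟨(2 * L ^ 2 + K + P + 1) / c, by positivity, fun γ h T s hs => ?_⟩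
  -- the modulated test
  set wT : ℝ → ℂ := fun t => cexp (-((T * t : ℝ) : ℂ) * I) * w t with hwT_def
  have hwT : IsWeilTest wT := isWeilTest_modulate hw T
  have hwTs : tsupport wT ⊆ Icc (-δ) δ := (tsupport_modulate_subset w T).trans hws
  have hwTsA : tsupport wT ⊆ Icc (-(B / 2)) (B / 2) :=
    hwTs.trans (Icc_subset_Icc (by linarith) hδA)
  have hwTsl : tsupport wT ⊆ Icc (-(Real.log 2 / 2)) (Real.log 2 / 2) :=
    hwTs.trans (Icc_subset_Icc (by linarith) hδl)
  -- (1) lower bound: each point near `T` costs `c`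
  have hcount : (s.card : ℝ) * c ≤ ∑ i ∈ s, ‖weilMellin wT (1 / 2 + (γ i : ℂ) * I)‖ ^ 2 := by
    have : ∑ _i ∈ s, c ≤ ∑ i ∈ s, ‖weilMellin wT (1 / 2 + (γ i : ℂ) * I)‖ ^ 2 := by
      refine Finset.sum_le_sum fun i hi => ?_
      have e : weilMellin wT (1 / 2 + (γ i : ℂ) * I) =
          weilMellin w (1 / 2 + ((γ i - T : ℝ) : ℂ) * I) := weilMellin_modulate w T (γ i)
      rw [e]
      exact hlow (γ i - T) (hs i hi)
    rwa [Finset.sum_const, nsmul_eq_mul] at this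
  -- (2) the sum is bounded by `Re Q(w_T)` (the only place where the family enters)
  have hsum : ∑ i ∈ s, ‖weilMellin wT (1 / 2 + (γ i : ℂ) * I)‖ ^ 2 ≤ (weilQuadratic wT).re :=
    sum_norm_sq_le_of_windowTrace h hwT hwTsA s
  -- (3) `Re Q(w_T)` in Yoshida's analytic form, bounded term by term
  have hQ : (weilQuadratic wT).re = weilArchQuadratic wT :=
    weilQuadratic_re_eq_weilArchQuadratic hwT hwTsl
  -- (3a) polar part
  have hLT : weilL1 wT = L := by
    rw [hL, weilL1, weilL1]
    refine integral_congr_ae (Eventually.of_forall fun t => ?_)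
    simp only [hwT_def, norm_modulate]
  have hpol : 2 * (weilMellin wT 0 * conj (weilMellin wT 1)).re ≤ 2 * L ^ 2 := by
    have h0 : ‖weilMellin wT 0‖ ≤ L := by
      rw [← hLT]; exact norm_weilMellin_le_weilL1 hwT.1.continuous hwT.2 (by simp) (by simp)
    have h1 : ‖weilMellin wT 1‖ ≤ L := by
      rw [← hLT]; exact norm_weilMellin_le_weilL1 hwT.1.continuous hwT.2 (by simp) (by simp)
    have h2 : (weilMellin wT 0 * conj (weilMellin wT 1)).re ≤
        ‖weilMellin wT 0‖ * ‖weilMellin wT 1‖ := by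
      refine (Complex.re_le_norm _).trans ?_
      rw [norm_mul, Complex.norm_conj]
    nlinarith [norm_nonneg (weilMellin wT 0), norm_nonneg (weilMellin wT 1)]
  -- (3b) the `L²` part is non-positive
  have hN : 0 ≤ Real.log π * ∫ t, ‖wT t‖ ^ 2 :=
    mul_nonneg (Real.log_nonneg (by linarith [Real.pi_gt_three]))
      (integral_nonneg fun _ => by positivity)
  -- (3c) the archimedean integral
  have hF : ∀ v : ℝ, |5 + Real.log (1 + |v|) + Real.log (1 + |T|)| ≤
      (6 + Real.log (1 + |T|)) + (1 / 2) * v ^ 2 := by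
    intro v
    have h1 : 0 ≤ Real.log (1 + |v|) := Real.log_nonneg (by linarith [abs_nonneg v])
    have h2 : 0 ≤ Real.log (1 + |T|) := Real.log_nonneg (by linarith [abs_nonneg T])
    have h3 : Real.log (1 + |v|) ≤ |v| := by
      have := Real.log_le_sub_one_of_pos (by linarith [abs_nonneg v] : (0 : ℝ) < 1 + |v|)
      linarith
    rw [abs_of_nonneg (by linarith)]
    nlinarith [sq_nonneg (|v| - 1), sq_abs v]
  have hint0 : Integrable fun v : ℝ => ‖weilMellin w (1 / 2 + v * I)‖ ^ 2 *
      (5 + Real.log (1 + |v|) + Real.log (1 + |T|)) := by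
    refine integrable_norm_sq_weilMellin_mul hw (by fun_prop) (by
      linarith [Real.log_nonneg (by linarith [abs_nonneg T] : (1 : ℝ) ≤ 1 + |T|)])
      (by norm_num) hF
  have hint1 : Integrable fun u : ℝ => ‖weilMellin w (1 / 2 + ((u - T : ℝ) : ℂ) * I)‖ ^ 2 *
      (5 + Real.log (1 + |u - T|) + Real.log (1 + |T|)) := by
    have := hint0.comp_sub_right T
    exact this
  have harch : ∫ u : ℝ, ‖weilMellin wT (1 / 2 + u * I)‖ ^ 2 *
        (Complex.digamma (1 / 4 + u / 2 * I)).re ≤ K + Real.log (1 + |T|) * P := by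
    calc ∫ u : ℝ, ‖weilMellin wT (1 / 2 + u * I)‖ ^ 2 * (Complex.digamma (1 / 4 + u / 2 * I)).re
        ≤ ∫ u : ℝ, ‖weilMellin w (1 / 2 + ((u - T : ℝ) : ℂ) * I)‖ ^ 2 *
            (5 + Real.log (1 + |u - T|) + Real.log (1 + |T|)) := by
          refine integral_mono (integrable_norm_sq_weilMellin_mul_reDigammaQuarter hwT) hint1
            fun u => ?_
          simp only
          rw [weilMellin_modulate w T u]
          refine mul_le_mul_of_nonneg_left ?_ (by positivity)
          have h1 := reDigammaQuarter_le_log u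
          have h2 : Real.log (1 + |u|) ≤ Real.log (1 + |u - T|) + Real.log (1 + |T|) := by
            rw [← Real.log_mul (by positivity) (by positivity)]
            refine Real.log_le_log (by positivity) ?_
            have : |u| ≤ |u - T| + |T| := by
              simpa using abs_add_le (u - T) T
            nlinarith [abs_nonneg (u - T), abs_nonneg T]
          change reDigammaQuarter u ≤ _
          linarith
      _ = ∫ v : ℝ, ‖weilMellin w (1 / 2 + v * I)‖ ^ 2 *
            (5 + Real.log (1 + |v|) + Real.log (1 + |T|)) := by
          have := integral_sub_right_eq_self (μ := (volume : Measure ℝ))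
            (fun v : ℝ => ‖weilMellin w (1 / 2 + v * I)‖ ^ 2 *
              (5 + Real.log (1 + |v|) + Real.log (1 + |T|))) T
          simpa using this
      _ = K + Real.log (1 + |T|) * P := by
          have e : (fun v : ℝ => ‖weilMellin w (1 / 2 + v * I)‖ ^ 2 *
              (5 + Real.log (1 + |v|) + Real.log (1 + |T|))) =
              fun v : ℝ => ‖weilMellin w (1 / 2 + v * I)‖ ^ 2 * (5 + Real.log (1 + |v|)) +
                Real.log (1 + |T|) * ‖weilMellin w (1 / 2 + v * I)‖ ^ 2 := by
            funext v; ring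
          have hi1 : Integrable fun v : ℝ => ‖weilMellin w (1 / 2 + v * I)‖ ^ 2 *
              (5 + Real.log (1 + |v|)) := by
            refine integrable_norm_sq_weilMellin_mul hw (by fun_prop) (by norm_num : (0:ℝ) ≤ 6)
              (by norm_num : (0:ℝ) ≤ 1 / 2) fun v => ?_
            have h1 : 0 ≤ Real.log (1 + |v|) := Real.log_nonneg (by linarith [abs_nonneg v])
            have h3 : Real.log (1 + |v|) ≤ |v| := by
              have := Real.log_le_sub_one_of_pos (by linarith [abs_nonneg v] : (0 : ℝ) < 1 + |v|)
              linarith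
            rw [abs_of_nonneg (by linarith)]
            nlinarith [sq_nonneg (|v| - 1), sq_abs v]
          have hi2 : Integrable fun v : ℝ =>
              Real.log (1 + |T|) * ‖weilMellin w (1 / 2 + v * I)‖ ^ 2 :=
            (integrable_norm_sq_weilMellin_half_line hw).const_mul _
          rw [e, integral_add hi1 hi2, MeasureTheory.integral_const_mul]
  -- (4) assemble
  have hQle : (weilQuadratic wT).re ≤ 2 * L ^ 2 + K + P * Real.log (1 + |T|) := by
    rw [hQ, weilArchQuadratic]
    have hpi : 1 / (2 * π) * (K + Real.log (1 + |T|) * P) ≤ K + Real.log (1 + |T|) * P := by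
      have hX : 0 ≤ K + Real.log (1 + |T|) * P := by
        have := Real.log_nonneg (by linarith [abs_nonneg T] : (1 : ℝ) ≤ 1 + |T|)
        positivity
      have h12 : 1 / (2 * π) ≤ 1 := by
        rw [div_le_one (by positivity)]; linarith [Real.pi_gt_three]
      nlinarith
    have harch' : 1 / (2 * π) * ∫ u : ℝ, ‖weilMellin wT (1 / 2 + u * I)‖ ^ 2 *
        (Complex.digamma (1 / 4 + u / 2 * I)).re ≤ 1 / (2 * π) * (K + Real.log (1 + |T|) * P) :=
      mul_le_mul_of_nonneg_left harch (by positivity)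
    nlinarith
  have hlogT : 0 ≤ Real.log (1 + |T|) := Real.log_nonneg (by linarith [abs_nonneg T])
  have hmain : (s.card : ℝ) * c ≤ 2 * L ^ 2 + K + P * Real.log (1 + |T|) :=
    hcount.trans (hsum.trans hQle)
  rw [div_mul_eq_mul_div, le_div_iff₀ hc]
  nlinarith

/-! ### Decay of `ĝ` on the critical line, and on integer cells -/

/-- **Quadratic decay on the critical line**: `‖ĝ(1/2 + iu)‖ ≤ (C_g + C_{g''}) / (1 + u²)²` for a
Weil test `g` (`norm_weilMellin_le` for `g` and for `g''`, with `(g'')^(s) = (s - 1/2)² ĝ(s)`).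
[folklore] -/
theorem norm_weilMellin_line_le_sq {g : ℝ → ℂ} (hg : IsWeilTest g) (u : ℝ) :
    ‖weilMellin g (1 / 2 + u * I)‖ ≤
      (weilDecayConst g + weilDecayConst (deriv (deriv g))) / (1 + u ^ 2) ^ 2 := by
  set s : ℂ := 1 / 2 + u * I with hs
  have hre : s.re = 1 / 2 := by simp [hs]
  have him : s.im = u := by simp [hs]
  have h1 := norm_weilMellin_le hg (s := s) (by rw [hre]; norm_num) (by rw [hre]; norm_num)
  have h2 := norm_weilMellin_le hg.deriv.deriv (s := s) (by rw [hre]; norm_num)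
    (by rw [hre]; norm_num)
  rw [weilMellin_deriv_deriv hg, norm_mul, him] at h2
  rw [him] at h1
  have h3 : ‖(s - 1 / 2) ^ 2‖ = u ^ 2 := by
    rw [hs, add_sub_cancel_left, norm_pow, norm_mul, Complex.norm_real, Complex.norm_I, mul_one,
      Real.norm_eq_abs, sq_abs]
  rw [h3] at h2
  have hpos : 0 < 1 + u ^ 2 := by positivity
  rw [le_div_iff₀ hpos] at h1 h2
  rw [le_div_iff₀ (by positivity)]
  have hn := norm_nonneg (weilMellin g s)
  nlinarith

/-- **Decay on a cell**: for `u ∈ [n, n+1]` (`n : ℤ`),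
`‖ĝ(1/2 + iu)‖ ≤ 16 (C_g + C_{g''}) / (1 + n²)²` (since `1 + n² ≤ 4 (1 + u²)`). [folklore] -/
theorem norm_weilMellin_cell_le {g : ℝ → ℂ} (hg : IsWeilTest g) {n : ℤ} {u : ℝ}
    (hu : u ∈ Icc (n : ℝ) (n + 1)) :
    ‖weilMellin g (1 / 2 + u * I)‖ ≤
      16 * (weilDecayConst g + weilDecayConst (deriv (deriv g))) / (1 + (n : ℝ) ^ 2) ^ 2 := by
  have hD : 0 ≤ weilDecayConst g + weilDecayConst (deriv (deriv g)) :=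
    add_nonneg (weilDecayConst_nonneg _) (weilDecayConst_nonneg _)
  refine (norm_weilMellin_line_le_sq hg u).trans ?_
  rw [div_le_div_iff₀ (by positivity) (by positivity)]
  have h0 : (u - n) ^ 2 ≤ 1 := by nlinarith [hu.1, hu.2]
  have hn2 : (n : ℝ) ^ 2 ≤ 2 * u ^ 2 + 2 * (u - n) ^ 2 := by nlinarith [sq_nonneg (u + (u - n))]
  have h1 : (1 + (n : ℝ) ^ 2) ^ 2 ≤ 16 * (1 + u ^ 2) ^ 2 := by
    have h4 : 1 + (n : ℝ) ^ 2 ≤ 4 * (1 + u ^ 2) := by nlinarith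
    have h5 : 0 ≤ 1 + (n : ℝ) ^ 2 := by positivity
    nlinarith
  calc (weilDecayConst g + weilDecayConst (deriv (deriv g))) * (1 + (n : ℝ) ^ 2) ^ 2
      ≤ (weilDecayConst g + weilDecayConst (deriv (deriv g))) * (16 * (1 + u ^ 2) ^ 2) :=
        mul_le_mul_of_nonneg_left h1 hD
    _ = 16 * (weilDecayConst g + weilDecayConst (deriv (deriv g))) * (1 + u ^ 2) ^ 2 := by ring

/-! ### Cells: finiteness, regrouping, the dominating sequence -/

/-- If every finset of elements satisfying `p` has at most `K` elements, then `{i // p i}` is a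
finite type with `Nat.card ≤ K`. [folklore] -/
theorem finite_and_natCard_le {α : Type*} {p : α → Prop} {K : ℝ}
    (h : ∀ s : Finset α, (∀ i ∈ s, p i) → (s.card : ℝ) ≤ K) :
    Finite {i // p i} ∧ (Nat.card {i // p i} : ℝ) ≤ K := by
  have hmap : ∀ s : Finset {i // p i}, ((s.map (Function.Embedding.subtype p)).card : ℝ) ≤ K :=
    fun s => h _ fun i hi => by
      obtain ⟨x, -, rfl⟩ := Finset.mem_map.1 hi
      exact x.2
  have hfin : Finite {i // p i} := by
    by_contra hinf
    rw [not_finite_iff_infinite] at hinf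
    obtain ⟨s, hs⟩ := Infinite.exists_subset_card_eq {i // p i} (⌊K⌋₊ + 1)
    have h1 := hmap s
    rw [Finset.card_map, hs] at h1
    have h2 := Nat.lt_floor_add_one K
    push_cast at h1
    linarith
  refine ⟨hfin, ?_⟩
  haveI := Fintype.ofFinite {i // p i}
  have h1 := hmap Finset.univ
  rwa [Finset.card_map, Finset.card_univ, ← Nat.card_eq_fintype_card] at h1

/-- Regrouping a `HasSum` along the fibres of an integer-valued map with finite fibres.
[folklore] -/
theorem hasSum_fiber {ι : Type*} {F : ι → ℂ} {a : ℂ} (cls : ι → ℤ)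
    (hfin : ∀ n, Finite {i // cls i = n}) (h : HasSum F a) :
    HasSum (fun n : ℤ => ∑' i : {i // cls i = n}, F i.1) a := by
  have h2 : HasSum (F ∘ (Equiv.sigmaFiberEquiv cls)) a := (Equiv.hasSum_iff _).2 h
  refine h2.sigma fun n => ?_
  haveI := hfin n
  simp only [Function.comp_def, Equiv.sigmaFiberEquiv_apply]
  exact Summable.of_finite.hasSum

/-- `Σ_{n ∈ ℤ} 1 / (1 + n²) < ∞`. [folklore] -/
theorem summable_one_div_one_add_sq : Summable fun n : ℤ => 1 / (1 + (n : ℝ) ^ 2) := by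
  have hsq : Summable fun n : ℤ => 1 / (n : ℝ) ^ 2 := Real.summable_one_div_int_pow.2 one_lt_two
  refine Summable.of_norm_bounded_eventually hsq ?_
  filter_upwards [eventually_cofinite_ne 0] with n hn
  rw [Real.norm_of_nonneg (by positivity)]
  have hn' : (n : ℝ) ≠ 0 := Int.cast_ne_zero.2 hn
  have hn2 : 0 < (n : ℝ) ^ 2 := by positivity
  exact one_div_le_one_div_of_le hn2 (by linarith)

/-- The dominating sequence of the cell-wise limit is summable:
`Σ_n C (2 + |n|) · 16 D / (1 + n²)² < ∞`. [folklore] -/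
theorem summable_cellBound (C D : ℝ) (hD : 0 ≤ D) :
    Summable fun n : ℤ => C * (2 + |(n : ℝ)|) * (16 * D / (1 + (n : ℝ) ^ 2) ^ 2) := by
  have hmain : Summable fun n : ℤ => (2 + |(n : ℝ)|) * (16 * D / (1 + (n : ℝ) ^ 2) ^ 2) := by
    refine Summable.of_nonneg_of_le (fun n => by positivity) (fun n => ?_)
      ((summable_one_div_one_add_sq).mul_left (48 * D))
    have hpos : 0 < 1 + (n : ℝ) ^ 2 := by positivity
    rw [mul_div_assoc', div_le_iff₀ (by positivity), mul_one_div, div_mul_eq_mul_div,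
      le_div_iff₀ hpos]
    have h1 : |(n : ℝ)| ≤ 1 + (n : ℝ) ^ 2 := by nlinarith [sq_abs (n : ℝ), abs_nonneg (n : ℝ)]
    have h2 : 2 + |(n : ℝ)| ≤ 3 * (1 + (n : ℝ) ^ 2) := by nlinarith [sq_nonneg (n : ℝ)]
    have h3 := mul_le_mul_of_nonneg_left h2 (by positivity : (0 : ℝ) ≤ 16 * D * (1 + (n : ℝ) ^ 2))
    nlinarith [h3]
  simpa only [mul_assoc] using hmain.mul_left C

/-! ### Landing anchor -/

/-- **Landing anchor of this auxiliary file** (registered sub-goal `stub_closedLadder_cells` of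
item stmt-RiemannHypothesis-0187, stub `stub_closedLadder`): binder-free restatement of the
uniform local Weyl bound `exists_uniform_card_near_le_log`. [folklore] -/
theorem stub_closedLadder_cells : ∀ {B : ℝ}, 0 < B → ∃ C : ℝ, 0 < C ∧ ∀ {ι : Type} (γ : ι → ℝ),
    (∀ g : ℝ → ℂ, IsWeilTest g → tsupport g ⊆ Set.Icc (-B) B →
      HasSum (fun i => weilMellin g (1 / 2 + (γ i : ℂ) * I)) (weilFunctional g)) →
    ∀ (T : ℝ) (s : Finset ι), (∀ i ∈ s, |γ i - T| ≤ 1) →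
      (s.card : ℝ) ≤ C * (1 + Real.log (1 + |T|)) :=
  fun hB => exists_uniform_card_near_le_log hB

end Summit.RiemannHypothesis.RiemannHypothesis.Theorems.SpectralThesis.Sketch.ClosedLadder

end
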